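import Summits.CriticalPhenomena.Ising3DConformalLimit.Theses.CoerciveSharpness
import Literature.Barriers.CriticalPhenomena.AxisProfileAxiomaticsNoDoubling
import Literature.Probability.LatticeModels.IsingExponentsProofs
import Literature.Probability.LatticeModels.CriticalTwoPointDCPLowerHolds
import Literature.Probability.LatticeModels.CriticalTwoPointBounds
import Literature.Probability.LatticeModels.PointwiseScalingLimitEtaExists
import HarnessLib

/-!
# Disproof of `DimensionPinned` — findings (crux stmt-CriticalPhenomena-4662, route `CoerciveSharpness` r6;
# shared with `ClusterRigidity.DimensionPinned` (support) and `HelsonAxis.EtaBoundsExist` (crux r5))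

Standing crux disprover `cdisprove-stmt-CriticalPhenomena-4662`, cycle 1 (2026-08-17).

The crux, verbatim: `DimensionPinned := ∃ η : ℝ, HasIsingEtaBounds 3 η`, i.e. (`dimensionPinned_iff`)
`∃ η c C, 0 < c ∧ ∀ x : Site 3, x ≠ 0 → c‖x‖^{-(1+η)} ≤ ⟨σ₀σ_x⟩⁺_{β_c(3)} ≤ C‖x‖^{-(1+η)}`
(sup norm on `Site 3 = Fin 3 → ℤ`, `Real.rpow`, `(3:ℝ) - 2 + η`, no ℕ-subtraction, no junk value:
`criticalTwoPoint 3 x > 0` and `≤ 1`).  TWO-SIDED PURE-POWER bounds with ONE exponent.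

## Findings (kernel-checked unless marked "remark")

0. **VERDICT: NO KILL.**  The statement is an open problem believed TRUE (conformal bootstrap / Monte Carlo:
   `⟨σ₀σ_x⟩ ≈ A‖x‖₂^{-2Δ_σ}(1 + B‖x‖^{-ω} + …)`, `2Δ_σ = 1 + η`, `η = 0.036298(2)`, `ω ≈ 0.83`; a convergent
   correction series is exactly "bounded multiplicative corrections", i.e. the crux).  A refutation `¬ DimensionPinned`
   would be a PROOF that for every `η` the ratio `⟨σ₀σ_x⟩·‖x‖^{1+η}` is unbounded above or not bounded away from
   `0` on `ℤ³ ∖ {0}` — an unbounded slowly-varying correction or direction-dependent exponents at `β_c(3)`.  Nothing in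
   print or in the tree points that way (ADC21 §5.6: "for now we do not have an unconditional proof" of regularity —
   absence of proof, not evidence of failure).  No finite computation can bite (§1: the statement is invariant under
   changing `G` on any bounded set), so no `kit compute` job was submitted.
1. **`∀ x ≠ 0` is not load-bearing** (`dimensionPinned_iff_atInfinity`): bounds beyond ANY radius `R` upgrade to all
   `x ≠ 0` by the a-priori envelope `c₀‖x‖⁻² ≤ G ≤ 1` (pure algebra on `[1, R]`, no finiteness argument).  So the
   crux is a statement about `‖x‖ → ∞` only; small-`x` numerics are irrelevant to it in kind.
2. **Every syntactic weakening is ALREADY A THEOREM** (`withoutLower_holds`, `withoutUpper_holds`,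
   `withoutSharedExponent_holds`, `withoutPosConst_holds`): drop the lower bound (`η = 0` works, infrared bound),
   drop the upper bound (`η = 1`, Simon–Lieb), allow two exponents (`(η₁, η₂) = (1, 0)`), or drop `0 < c` (`c = 0`) —
   each is closed by `criticalTwoPoint_bounds_holds`.  The ENTIRE content of the crux is the COINCIDENCE of the two
   exponents; there is no removable hypothesis and no "morally unnecessary" side condition (nothing is misstated).
3. **Excluded witnesses** (`not_hasIsingEtaBounds_of_neg`, `not_hasIsingEtaBounds_of_one_lt`,
   `not_hasIsingEtaBounds_of_gt_half`, `dimensionPinned_iff_Icc`, `hasIsingEtaBounds_unique`): `η < 0` contradicts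
   the infrared bound, `η > 1` the Simon–Lieb floor, `η > 1/2` Duminil-Copin–Panis Thm 1.5 (tree
   `dcp_isingEta_le_half_holds`); so `DimensionPinned ↔ ∃ η ∈ [0, 1/2], HasIsingEtaBounds 3 η`, and `η` is unique.
   The two ENDPOINTS are themselves open items of other routes (remark): `HasIsingEtaBounds 3 0 ↔ ¬ PerfectScreening.NonSaturation`
   (landed `not_nonSaturation_iff_hasIsingEtaBounds_zero`) and `HasIsingEtaBounds 3 (1/2) → ¬ LatticeSDPCertificates.WindowBelowHalf`
   (landed `not_windowBelowHalf_of_hasIsingEtaBounds_half`); in THIS route `η = 1/2` is excluded downstream by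
   `WindowOfGrowth` (proved, p157968) once `CoerciveReflectedGradient` holds.
4. **BARRIER REDUCTION — why it resists from below** (`profilePinned_of_dimensionPinned`,
   `axisDoubling_of_profilePinned`, `exists_axisProfileFacts_not_profilePinned`, `not_forall_axisProfilePinningFor`):
   the crux implies two-sided power bounds for the axis profile `g(n) = ⟨σ₀σ_{ne₀}⟩`, which imply all-scale
   doubling; but the catalogued barrier `Literature.Barriers.CriticalPhenomena.AxisProfileAxiomaticsNoDoubling`
   exhibits a profile with EVERY axis-profile fact the tree knows (positivity, MMS monotonicity, RP log-convexity, the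
   full Källén–Lehmann shape, both envelopes, the sliding-scale infrared bound, DC–Panis Thm 1.3 in profile form, even
   the fat floor `g ≥ n^{-3/2}/96` = "envelope-η ≤ 1/2 at every scale") and NO doubling, hence no pinning.  So the
   technique class "axis-profile axiomatics" cannot prove the crux: any proof must see the Gibbs / random-current
   structure (or a cross-scale RATE, §5), exactly as the picked line `Sketch` (octave-telescoping-block-dock) does
   through its dock `DCR₂₇`.
5. **The RATE is load-bearing in any octave/doubling approach** (`exists_octaveRatioLimit_not_profilePinned`):
   convergence of the octave ratio `g(2n)/g(n) → 2^{-s}` WITHOUT a summable rate does not pin (witness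
   `g(n) = 1/(n(1 + log n))`: positive, inside the envelope `[1/n², 1/n]`, octave ratio `→ 1/2`, not
   power-bounded for any exponent).  Cf. CensusWeb `dimensionPinned_of_dyadicDiniLaw` (a power rate suffices).
6. **Natural strengthenings** (remarks, not refutable from the cone): (i) exact law `G = A‖x‖_∞^{-(1+η)}` is
   consistent with every lattice fact in the tree (MMS, hyperoctahedral symmetry, RP log-convexity) though physically
   false (the limit is rotation invariant; `LimitRotationInvariant` is only proved modulo `HRP2Rigidity` and needs a full
   n-point limit) — so even TIGHTNESS `C/c ≥ 3^{(1+η)/2}` is out of reach; (ii) `η = 0` (Coulomb saturation) is open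
   both ways (= ¬NonSaturation); (iii) the `d ≥ 5` analogue is TRUE (`η = 0`, DC–Panis Thm 1.4 + infrared bound) and
   the `d = 2` analogue is TRUE (`η = 1/4`, Wu; tree `PlanarIsingCriticalTwoPointDecay`) — the crux holds wherever it
   is decidable today; (iv) off criticality the analogue is FALSE for `β < β_c` (exponential decay) — `β = β_c` is used.
7. **Targets**: none this cycle (payload `stuck_stubs = []`; `Lines/` empty at start; PICKED = `Sketch`, stubs not yet
   registered).  Pre-positioned for the line: §4 (profile facts are not enough — the dock must carry genuine
   cross-scale information) and §5 (a rate, not a limit, is what the transfer needs).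

Disproof used from other seats: none existed (first Disproof.lean of this crux).  Inputs read: STRATEGY-CENSUS.md,
CensusWeb.lean (equivalences crux ⟺ AxisPinned ⟺ DyadicPinned ⟺ QM⁺∧QM⁻; not re-proved here), PICKED.md, the two idea
cards, the rattack briefing note on the item, `Cruxes/WindowOfGrowth/Disproof.lean` (sibling, same route).
-/

noncomputable section

namespace Summit.CriticalPhenomena.Ising3DConformalLimit.Cruxes.DimensionPinned.Disproof

open Filter Topology
open Literature.Probability.LatticeModels Literature.Barriers.CriticalPhenomena
open Summit.CriticalPhenomena.Ising3DConformalLimit.Theses.CoerciveSharpness (DimensionPinned)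

/-! ## §0 Read-back and the a-priori envelope -/

/-- `(3:ℝ) - 2 + η = 1 + η` (the cast in `HasIsingEtaBounds 3 η`). -/
theorem three_sub_two (η : ℝ) : ((3 : ℕ) : ℝ) - 2 + η = 1 + η := by push_cast; ring

/-- **Read-back of the crux**: two-sided pure-power bounds with one exponent, sup norm, all `x ≠ 0`. -/
theorem dimensionPinned_iff :
    DimensionPinned ↔ ∃ η c C : ℝ, 0 < c ∧ ∀ x : Site 3, x ≠ 0 →
      c * (‖x‖ : ℝ) ^ (-(1 + η)) ≤ criticalTwoPoint 3 x ∧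
        criticalTwoPoint 3 x ≤ C * (‖x‖ : ℝ) ^ (-(1 + η)) := by
  simp only [DimensionPinned, HasIsingEtaBounds, IsPowerBounded, three_sub_two]

/-- The a-priori envelope on `ℤ³` (tree `criticalTwoPoint_bounds_holds` = Simon–Lieb floor + infrared bound):
`c₀‖x‖⁻² ≤ ⟨σ₀σ_x⟩_{β_c(3)} ≤ C₀‖x‖⁻¹` for `x ≠ 0`. [cite: DuminilCopin2019, Thm. 4.8] -/
theorem envelope : ∃ c₀ C₀ : ℝ, 0 < c₀ ∧ ∀ x : Site 3, x ≠ 0 →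
    c₀ * (‖x‖ : ℝ) ^ (-(2 : ℝ)) ≤ criticalTwoPoint 3 x ∧
      criticalTwoPoint 3 x ≤ C₀ * (‖x‖ : ℝ) ^ (-(1 : ℝ)) := by
  obtain ⟨c, C, hc, hb⟩ := criticalTwoPoint_bounds_holds (d := 3) le_rfl
  refine ⟨c, C, hc, fun x hx => ?_⟩
  have h := hb x hx
  have e1 : (-(((3 : ℕ) : ℝ) - 1)) = -(2 : ℝ) := by norm_num
  have e2 : (-(((3 : ℕ) : ℝ) - 2)) = -(1 : ℝ) := by norm_num
  rw [e1, e2] at h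
  exact h

/-- `1 ≤ ‖x‖` for `x ≠ 0` in `ℤ³` (sup norm of an integer vector). [folklore] -/
theorem one_le_norm {x : Site 3} (hx : x ≠ 0) : (1 : ℝ) ≤ ‖x‖ := by
  obtain ⟨i, hi⟩ := Function.ne_iff.1 hx
  have h1 : (1 : ℝ) ≤ ‖x i‖ := by
    rw [Int.norm_eq_abs]
    exact_mod_cast Int.one_le_abs hi
  exact h1.trans (norm_le_pi_norm x i)

/-- `⟨σ₀σ_x⟩_{β_c(3)} > 0` (from the Simon–Lieb floor). [folklore] -/
theorem twoPoint_pos {x : Site 3} (hx : x ≠ 0) : 0 < criticalTwoPoint 3 x := by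
  obtain ⟨c₀, C₀, hc₀, hb⟩ := envelope
  have hn : (0 : ℝ) < ‖x‖ := lt_of_lt_of_le one_pos (one_le_norm hx)
  exact lt_of_lt_of_le (mul_pos hc₀ (Real.rpow_pos_of_pos hn _)) (hb x hx).1

/-- `‖n e₀‖ = n`. [folklore] -/
theorem norm_axis (n : ℕ) : ‖(Pi.single 0 (n : ℤ) : Site 3)‖ = n := by
  rw [Pi.norm_single, Int.norm_eq_abs]
  push_cast
  exact abs_of_nonneg (Nat.cast_nonneg n)

/-- `n e₀ ≠ 0` for `n ≥ 1`. [folklore] -/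
theorem axis_ne_zero {n : ℕ} (hn : 1 ≤ n) : (Pi.single 0 (n : ℤ) : Site 3) ≠ 0 := by
  intro h
  have h0 := congrFun h 0
  simp at h0
  omega

/-! ## §1 `∀ x ≠ 0` versus `‖x‖ → ∞`: not load-bearing -/

/-- The crux demanded only beyond some radius `R`. -/
def DimensionPinnedAtInfinity : Prop :=
  ∃ η c C R : ℝ, 0 < c ∧ ∀ x : Site 3, x ≠ 0 → R ≤ ‖x‖ →
    c * (‖x‖ : ℝ) ^ (-(1 + η)) ≤ criticalTwoPoint 3 x ∧
      criticalTwoPoint 3 x ≤ C * (‖x‖ : ℝ) ^ (-(1 + η))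

/-- **Bounds at infinity upgrade to bounds everywhere**: on `1 ≤ ‖x‖ ≤ R` the envelope floor `c₀‖x‖⁻²`
dominates `c'‖x‖^{-(1+η)}` with `c' = c₀ · min 1 R^{-(1-η)}`, and `G ≤ 1 ≤ max 1 R^{1+η} · ‖x‖^{-(1+η)}`.
Hence `DimensionPinned ↔ DimensionPinnedAtInfinity`: the quantifier `∀ x ≠ 0` carries no content. -/
theorem dimensionPinned_iff_atInfinity : DimensionPinned ↔ DimensionPinnedAtInfinity := by
  rw [dimensionPinned_iff]
  constructor
  · rintro ⟨η, c, C, hc, hb⟩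
    exact ⟨η, c, C, 0, hc, fun x hx _ => hb x hx⟩
  · rintro ⟨η, c, C, R, hc, hb⟩
    obtain ⟨c₀, C₀, hc₀, henv⟩ := envelope
    -- work with R' = max R 1 ≥ 1
    set R' : ℝ := max R 1 with hR'
    have hR'1 : (1 : ℝ) ≤ R' := le_max_right _ _
    have hR'0 : (0 : ℝ) < R' := lt_of_lt_of_le one_pos hR'1
    -- lower constant on the bounded region
    set cl : ℝ := c₀ * min 1 (R' ^ (-(1 - η))) with hcl
    have hcl0 : 0 < cl := mul_pos hc₀ (lt_min one_pos (Real.rpow_pos_of_pos hR'0 _))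
    -- upper constant on the bounded region
    set Cu : ℝ := max 1 (R' ^ (1 + η)) with hCu
    refine ⟨η, min c cl, max C Cu, lt_min hc hcl0, fun x hx => ?_⟩
    have hx1 : (1 : ℝ) ≤ ‖x‖ := one_le_norm hx
    have hx0 : (0 : ℝ) < ‖x‖ := lt_of_lt_of_le one_pos hx1
    have hpow0 : (0 : ℝ) ≤ (‖x‖ : ℝ) ^ (-(1 + η)) := (Real.rpow_pos_of_pos hx0 _).le
    rcases le_or_gt R' ‖x‖ with hfar | hnear
    · -- far region: the given bounds, weakened
      have h := hb x hx ((le_max_left R 1).trans hfar)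
      constructor
      · exact (mul_le_mul_of_nonneg_right (min_le_left _ _) hpow0).trans h.1
      · exact h.2.trans (mul_le_mul_of_nonneg_right (le_max_left _ _) hpow0)
    · -- near region `1 ≤ ‖x‖ < R'`: envelope
      have hxR : (‖x‖ : ℝ) ≤ R' := hnear.le
      have henvx := henv x hx
      constructor
      · -- lower: (min c cl) ‖x‖^{-(1+η)} ≤ cl ‖x‖^{-(1+η)} ≤ c₀ ‖x‖^{-2} ≤ G x
        refine (mul_le_mul_of_nonneg_right (min_le_right _ _) hpow0).trans (le_trans ?_ henvx.1)
        -- write ‖x‖^{-(1+η)} = ‖x‖^{-2} * ‖x‖^{1-η}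
        have hsplit : (‖x‖ : ℝ) ^ (-(1 + η)) = (‖x‖ : ℝ) ^ (-(2 : ℝ)) * (‖x‖ : ℝ) ^ (1 - η) := by
          rw [← Real.rpow_add hx0]; congr 1; ring
        rw [hsplit, hcl]
        have hkey : min 1 (R' ^ (-(1 - η))) * (‖x‖ : ℝ) ^ (1 - η) ≤ 1 := by
          rcases le_or_gt 0 (1 - η) with hpos | hneg
          · calc min 1 (R' ^ (-(1 - η))) * (‖x‖ : ℝ) ^ (1 - η)
                ≤ R' ^ (-(1 - η)) * R' ^ (1 - η) := by
                  apply mul_le_mul (min_le_right _ _) (Real.rpow_le_rpow hx0.le hxR hpos)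
                    (Real.rpow_nonneg hx0.le _) (Real.rpow_nonneg hR'0.le _)
              _ = 1 := by
                  rw [← Real.rpow_add hR'0]
                  simp
          · calc min 1 (R' ^ (-(1 - η))) * (‖x‖ : ℝ) ^ (1 - η)
                ≤ 1 * 1 := by
                  apply mul_le_mul (min_le_left _ _) (Real.rpow_le_one_of_one_le_of_nonpos hx1 hneg.le)
                    (Real.rpow_nonneg hx0.le _) zero_le_one
              _ = 1 := by ring
        have hx2 : (0 : ℝ) ≤ (‖x‖ : ℝ) ^ (-(2 : ℝ)) := Real.rpow_nonneg hx0.le _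
        calc c₀ * min 1 (R' ^ (-(1 - η))) * ((‖x‖ : ℝ) ^ (-(2 : ℝ)) * (‖x‖ : ℝ) ^ (1 - η))
            = c₀ * (‖x‖ : ℝ) ^ (-(2 : ℝ)) * (min 1 (R' ^ (-(1 - η))) * (‖x‖ : ℝ) ^ (1 - η)) := by ring
          _ ≤ c₀ * (‖x‖ : ℝ) ^ (-(2 : ℝ)) * 1 :=
              mul_le_mul_of_nonneg_left hkey (mul_nonneg hc₀.le hx2)
          _ = c₀ * (‖x‖ : ℝ) ^ (-(2 : ℝ)) := by ring
      · -- upper: G x ≤ 1 ≤ Cu * ‖x‖^{-(1+η)} ≤ (max C Cu) * ‖x‖^{-(1+η)}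
        refine le_trans ?_ (mul_le_mul_of_nonneg_right (le_max_right _ _) hpow0)
        refine (criticalTwoPoint_le_one' x).trans ?_
        rw [hCu]
        rcases le_or_gt 0 (-(1 + η)) with hpos | hneg
        · calc (1 : ℝ) = 1 * 1 := by ring
            _ ≤ max 1 (R' ^ (1 + η)) * (‖x‖ : ℝ) ^ (-(1 + η)) :=
                mul_le_mul (le_max_left _ _) (Real.one_le_rpow hx1 hpos) zero_le_one
                  (le_trans zero_le_one (le_max_left _ _))
        · calc (1 : ℝ) = R' ^ (1 + η) * R' ^ (-(1 + η)) := by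
                rw [← Real.rpow_add hR'0]
                simp
            _ ≤ max 1 (R' ^ (1 + η)) * (‖x‖ : ℝ) ^ (-(1 + η)) :=
                mul_le_mul (le_max_right _ _)
                  (Real.rpow_le_rpow_of_nonpos hx0 hxR hneg.le)
                  (Real.rpow_nonneg hR'0.le _) (le_trans zero_le_one (le_max_left _ _))

/-! ## §2 Every syntactic weakening is already a theorem: the content is the coincidence of exponents -/

/-- The crux without its LOWER bound. -/
def WithoutLower : Prop :=
  ∃ η C : ℝ, ∀ x : Site 3, x ≠ 0 → criticalTwoPoint 3 x ≤ C * (‖x‖ : ℝ) ^ (-(1 + η))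

/-- The crux without its UPPER bound. -/
def WithoutUpper : Prop :=
  ∃ η c : ℝ, 0 < c ∧ ∀ x : Site 3, x ≠ 0 → c * (‖x‖ : ℝ) ^ (-(1 + η)) ≤ criticalTwoPoint 3 x

/-- The crux with TWO exponents allowed (`η₁` below, `η₂` above). -/
def WithoutSharedExponent : Prop :=
  ∃ η₁ η₂ c C : ℝ, 0 < c ∧ ∀ x : Site 3, x ≠ 0 →
    c * (‖x‖ : ℝ) ^ (-(1 + η₁)) ≤ criticalTwoPoint 3 x ∧
      criticalTwoPoint 3 x ≤ C * (‖x‖ : ℝ) ^ (-(1 + η₂))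

/-- The crux without `0 < c`. -/
def WithoutPosConst : Prop :=
  ∃ η c C : ℝ, ∀ x : Site 3, x ≠ 0 →
    c * (‖x‖ : ℝ) ^ (-(1 + η)) ≤ criticalTwoPoint 3 x ∧
      criticalTwoPoint 3 x ≤ C * (‖x‖ : ℝ) ^ (-(1 + η))

/-- **Upper half alone: a theorem** (`η = 0`, infrared bound). -/
theorem withoutLower_holds : WithoutLower := by
  obtain ⟨c₀, C₀, hc₀, hb⟩ := envelope
  refine ⟨0, C₀, fun x hx => ?_⟩
  have h := (hb x hx).2
  have e : (-(1 + 0 : ℝ)) = -(1 : ℝ) := by norm_num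
  rw [e]
  exact h

/-- **Lower half alone: a theorem** (`η = 1`, Simon–Lieb floor). -/
theorem withoutUpper_holds : WithoutUpper := by
  obtain ⟨c₀, C₀, hc₀, hb⟩ := envelope
  refine ⟨1, c₀, hc₀, fun x hx => ?_⟩
  have h := (hb x hx).1
  have e : (-(1 + 1 : ℝ)) = -(2 : ℝ) := by norm_num
  rw [e]
  exact h

/-- **Two exponents allowed: a theorem** (`(η₁, η₂) = (1, 0)`; the best known pair — DC–Panis narrows only the
log-sense exponent, `η ≤ 1/2`, not this envelope). -/
theorem withoutSharedExponent_holds : WithoutSharedExponent := by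
  obtain ⟨c₀, C₀, hc₀, hb⟩ := envelope
  refine ⟨1, 0, c₀, C₀, hc₀, fun x hx => ?_⟩
  have h := hb x hx
  have e1 : (-(1 + 1 : ℝ)) = -(2 : ℝ) := by norm_num
  have e2 : (-(1 + 0 : ℝ)) = -(1 : ℝ) := by norm_num
  rw [e1, e2]
  exact h

/-- **`0 < c` dropped: a theorem** (`c = 0`, `η = 0`). -/
theorem withoutPosConst_holds : WithoutPosConst := by
  obtain ⟨c₀, C₀, hc₀, hb⟩ := envelope
  refine ⟨0, 0, C₀, fun x hx => ⟨?_, ?_⟩⟩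
  · simpa using criticalTwoPoint_nonneg' x
  · have h := (hb x hx).2
    have e : (-(1 + 0 : ℝ)) = -(1 : ℝ) := by norm_num
    rw [e]
    exact h

/-- The crux is `WithoutSharedExponent` on the diagonal `η₁ = η₂` (so its whole content is the coincidence). -/
theorem dimensionPinned_iff_diagonal :
    DimensionPinned ↔ ∃ η₁ η₂ c C : ℝ, η₁ = η₂ ∧ 0 < c ∧ ∀ x : Site 3, x ≠ 0 →
      c * (‖x‖ : ℝ) ^ (-(1 + η₁)) ≤ criticalTwoPoint 3 x ∧
        criticalTwoPoint 3 x ≤ C * (‖x‖ : ℝ) ^ (-(1 + η₂)) := by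
  rw [dimensionPinned_iff]
  constructor
  · rintro ⟨η, c, C, hc, hb⟩
    exact ⟨η, η, c, C, rfl, hc, hb⟩
  · rintro ⟨η, _, c, C, rfl, hc, hb⟩
    exact ⟨η, c, C, hc, hb⟩

/-! ## §3 Excluded witnesses: `η ∈ [0, 1/2]`, uniqueness -/

/-- **`η < 0` is excluded** by the infrared bound: along the axis `c₁ n^{-η} ≤ C₀` with `n^{-η} → ∞`. [folklore] -/
theorem not_hasIsingEtaBounds_of_neg {η : ℝ} (hη : η < 0) : ¬ HasIsingEtaBounds 3 η := by
  rintro ⟨c₁, C₁, hc₁, hb⟩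
  obtain ⟨c₀, C₀, hc₀, hbd⟩ := envelope
  have hbound : ∀ n : ℕ, 1 ≤ n → c₁ * (n : ℝ) ^ (-η) ≤ C₀ := by
    intro n hn
    have h1 := (hb _ (axis_ne_zero hn)).1
    have h2 := (hbd _ (axis_ne_zero hn)).2
    rw [norm_axis] at h1 h2
    have hn0 : (0 : ℝ) < n := by exact_mod_cast hn
    rw [three_sub_two, show -(1 + η) = -η + (-1) by ring, Real.rpow_add hn0, Real.rpow_neg_one] at h1
    rw [Real.rpow_neg_one] at h2
    have h3 : c₁ * (n : ℝ) ^ (-η) * (n : ℝ)⁻¹ ≤ C₀ * (n : ℝ)⁻¹ := by rw [mul_assoc]; exact h1.trans h2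
    exact le_of_mul_le_mul_right h3 (inv_pos.2 hn0)
  have ht : Tendsto (fun n : ℕ => c₁ * (n : ℝ) ^ (-η)) atTop atTop :=
    Tendsto.const_mul_atTop hc₁ ((tendsto_rpow_atTop (by linarith)).comp tendsto_natCast_atTop_atTop)
  obtain ⟨n, hgt, hge⟩ := ((ht.eventually_gt_atTop C₀).and (eventually_ge_atTop 1)).exists
  exact absurd (hbound n hge) (not_le.2 hgt)

/-- **`η > 1` is excluded** by the Simon–Lieb floor: along the axis `c₀ n^{η-1} ≤ C₁` with `n^{η-1} → ∞`
(elementary; subsumed by DC–Panis below but independent of it). [folklore] -/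
theorem not_hasIsingEtaBounds_of_one_lt {η : ℝ} (hη : 1 < η) : ¬ HasIsingEtaBounds 3 η := by
  rintro ⟨c₁, C₁, hc₁, hb⟩
  obtain ⟨c₀, C₀, hc₀, hbd⟩ := envelope
  have hbound : ∀ n : ℕ, 1 ≤ n → c₀ * (n : ℝ) ^ (η - 1) ≤ C₁ := by
    intro n hn
    have h1 := (hbd _ (axis_ne_zero hn)).1
    have h2 := (hb _ (axis_ne_zero hn)).2
    rw [norm_axis] at h1 h2
    have hn0 : (0 : ℝ) < n := by exact_mod_cast hn
    -- n^{-2} = n^{η-1} * n^{-(1+η)}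
    rw [show (-(2 : ℝ)) = (η - 1) + (-(1 + η)) by ring, Real.rpow_add hn0, ← mul_assoc] at h1
    rw [three_sub_two] at h2
    have hp : (0 : ℝ) < (n : ℝ) ^ (-(1 + η)) := Real.rpow_pos_of_pos hn0 _
    exact le_of_mul_le_mul_right (h1.trans h2) hp
  have ht : Tendsto (fun n : ℕ => c₀ * (n : ℝ) ^ (η - 1)) atTop atTop :=
    Tendsto.const_mul_atTop hc₀ ((tendsto_rpow_atTop (by linarith)).comp tendsto_natCast_atTop_atTop)
  obtain ⟨n, hgt, hge⟩ := ((ht.eventually_gt_atTop C₁).and (eventually_ge_atTop 1)).exists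
  exact absurd (hbound n hge) (not_le.2 hgt)

/-- DC–Panis Thm 1.5 on two-sided bounds: `HasIsingEtaBounds 3 η → η ≤ 1/2`.
[cite: DuminilCopinPanis2025LowerBounds, Theorem 1.5] -/
theorem eta_le_half {η : ℝ} (h : HasIsingEtaBounds 3 η) : η ≤ 1 / 2 :=
  dcp_isingEta_le_half_holds η h.hasIsingExponentEta'

/-- **`η > 1/2` is excluded** (DC–Panis Thm 1.5). -/
theorem not_hasIsingEtaBounds_of_gt_half {η : ℝ} (hη : 1 / 2 < η) : ¬ HasIsingEtaBounds 3 η :=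
  fun h => not_le.2 hη (eta_le_half h)

/-- `HasIsingEtaBounds 3 η → 0 ≤ η`. -/
theorem eta_nonneg {η : ℝ} (h : HasIsingEtaBounds 3 η) : 0 ≤ η :=
  not_lt.1 fun hη => not_hasIsingEtaBounds_of_neg hη h

/-- **The admissible window**: `DimensionPinned ↔ ∃ η ∈ [0, 1/2], HasIsingEtaBounds 3 η`. -/
theorem dimensionPinned_iff_Icc :
    DimensionPinned ↔ ∃ η ∈ Set.Icc (0 : ℝ) (1 / 2), HasIsingEtaBounds 3 η := by
  constructor
  · rintro ⟨η, h⟩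
    exact ⟨η, ⟨eta_nonneg h, eta_le_half h⟩, h⟩
  · rintro ⟨η, -, h⟩
    exact ⟨η, h⟩

/-- **Uniqueness of the witness**: two-sided bounds determine `η`. -/
theorem hasIsingEtaBounds_unique {η₁ η₂ : ℝ} (h₁ : HasIsingEtaBounds 3 η₁) (h₂ : HasIsingEtaBounds 3 η₂) :
    η₁ = η₂ :=
  h₁.hasIsingExponentEta'.unique h₂.hasIsingExponentEta'

/-- What a refutation must establish: for EVERY `η ∈ [0,1/2]` and every `0 < c`, `C`, a site `x ≠ 0` violating one
of the two bounds (`¬` pushed through `dimensionPinned_iff_Icc`). -/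
theorem not_dimensionPinned_iff :
    ¬ DimensionPinned ↔ ∀ η ∈ Set.Icc (0 : ℝ) (1 / 2), ∀ c C : ℝ, 0 < c →
      ∃ x : Site 3, x ≠ 0 ∧ (criticalTwoPoint 3 x < c * (‖x‖ : ℝ) ^ (-(1 + η)) ∨
        C * (‖x‖ : ℝ) ^ (-(1 + η)) < criticalTwoPoint 3 x) := by
  rw [dimensionPinned_iff_Icc]
  constructor
  · intro h η hη c C hc
    by_contra hcon
    push Not at hcon
    refine h ⟨η, hη, c, C, hc, fun x hx => ?_⟩
    obtain ⟨h1, h2⟩ := hcon x hx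
    rw [three_sub_two]
    exact ⟨h1, h2⟩
  · rintro h ⟨η, hη, c, C, hc, hb⟩
    obtain ⟨x, hx, hx'⟩ := h η hη c C hc
    have hbx := hb x hx
    rw [three_sub_two] at hbx
    rcases hx' with hlt | hlt
    · exact absurd hbx.1 (not_le.2 hlt)
    · exact absurd hbx.2 (not_le.2 hlt)

/-! ## §4 Barrier reduction: the axis-profile facts do not pin the exponent -/

/-- Two-sided pure-power bounds for an abstract axis profile `g : ℕ → ℝ` (the shape of CensusWeb's `AxisPinned`). -/
def ProfilePinned (g : ℕ → ℝ) : Prop :=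
  ∃ s c C : ℝ, 0 < c ∧ ∀ n : ℕ, 1 ≤ n → c * (n : ℝ) ^ (-s) ≤ g n ∧ g n ≤ C * (n : ℝ) ^ (-s)

/-- The critical axis profile `g(n) = ⟨σ₀σ_{n e₀}⟩_{β_c(3)}`. -/
def isingProfile (n : ℕ) : ℝ := criticalTwoPoint 3 (Pi.single 0 (n : ℤ))

/-- **The crux pins the axis profile** (restriction to the axis; the converse is CensusWeb's
`dimensionPinned_iff_axisPinned`, by the MMS sphere sandwich). -/
theorem profilePinned_of_dimensionPinned (h : DimensionPinned) : ProfilePinned isingProfile := by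
  obtain ⟨η, c, C, hc, hb⟩ := h
  refine ⟨1 + η, c, C, hc, fun n hn => ?_⟩
  have h := hb _ (axis_ne_zero hn)
  rw [norm_axis, three_sub_two] at h
  exact h

/-- **Pinning gives all-scale doubling** (`κ = c 2^{-s}/C`). [folklore] -/
theorem axisDoubling_of_profilePinned {g : ℕ → ℝ} (h : ProfilePinned g) : AxisDoubling g := by
  obtain ⟨s, c, C, hc, hb⟩ := h
  have hC : 0 < C := by
    have h1 := hb 1 le_rfl
    simp only [Nat.cast_one, Real.one_rpow, mul_one] at h1
    linarith [h1.1, h1.2]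
  refine ⟨c * (2 : ℝ) ^ (-s) / C, by positivity, fun n hn => ?_⟩
  have hn0 : (0 : ℝ) < n := by exact_mod_cast hn
  have h2n := (hb (2 * n) (by omega)).1
  have hn' := (hb n hn).2
  have e : ((2 * n : ℕ) : ℝ) ^ (-s) = (2 : ℝ) ^ (-s) * (n : ℝ) ^ (-s) := by
    push_cast
    exact Real.mul_rpow (by norm_num) hn0.le
  rw [e] at h2n
  have hns : g n / C ≤ (n : ℝ) ^ (-s) := by
    rw [div_le_iff₀ hC]
    linarith [hn']
  calc c * (2 : ℝ) ^ (-s) / C * g n = c * (2 : ℝ) ^ (-s) * (g n / C) := by ring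
    _ ≤ c * (2 : ℝ) ^ (-s) * (n : ℝ) ^ (-s) := by
        apply mul_le_mul_of_nonneg_left hns
        positivity
    _ = c * ((2 : ℝ) ^ (-s) * (n : ℝ) ^ (-s)) := by ring
    _ ≤ g (2 * n) := h2n

/-- Hence the crux implies `TwoPointDoubling` (item 6150) in profile form (also CensusWeb / landed
`twoPointDoubling_of_hasIsingEtaBounds`). -/
theorem axisDoubling_isingProfile_of_dimensionPinned (h : DimensionPinned) : AxisDoubling isingProfile :=
  axisDoubling_of_profilePinned (profilePinned_of_dimensionPinned h)

/-- **The barrier witness is not pinned**: `AxisProfileNoDoubling.g` (lacunary Källén–Lehmann mixture) has no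
doubling, hence no two-sided power bounds. -/
theorem not_profilePinned_witness : ¬ ProfilePinned AxisProfileNoDoubling.g :=
  fun h => AxisProfileNoDoubling.not_axisDoubling_g (axisDoubling_of_profilePinned h)

/-- **BARRIER REDUCTION** (`Literature.Barriers.CriticalPhenomena.AxisProfileAxiomaticsNoDoubling` ⇒ this crux):
a profile with every axis-profile fact of the tree (positivity, `g 0 = 1`, MMS antitone, RP ratio-monotone, level
envelope, Simon–Lieb envelope, sliding-scale infrared bound, DC–Panis Thm 1.3 in profile form), the full
Källén–Lehmann shape, the antitone level `(n+1)g(n+1) ≤ n g(n)` and the FAT floor `n√n·g(n) ≥ 1/96` at every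
scale — and NO two-sided power bounds. -/
theorem exists_axisProfileFacts_not_profilePinned :
    ∃ g : ℕ → ℝ, AxisProfileFacts g ∧ HasAxisSpectralRepresentation g ∧
      (∀ n : ℕ, 1 ≤ n → ((n : ℝ) + 1) * g (n + 1) ≤ n * g n) ∧
      (∀ n : ℕ, 1 ≤ n → 1 / 96 ≤ n * Real.sqrt n * g n) ∧ ¬ ProfilePinned g := by
  obtain ⟨g, hF, hKL, hlev, hfat, hnd⟩ := exists_axisProfileFacts_not_axisDoubling
  exact ⟨g, hF, hKL, hlev, hfat, fun h => hnd (axisDoubling_of_profilePinned h)⟩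

/-- The technique class "pin the exponent from the axis-profile facts (+ Källén–Lehmann)". -/
def AxisProfilePinningFor (g : ℕ → ℝ) : Prop :=
  AxisProfileFacts g → HasAxisSpectralRepresentation g → ProfilePinned g

/-- **Its master statement is false.** Any proof of `DimensionPinned` must use input on `⟨σ₀σ_{ne₀}⟩` beyond
the axis-profile facts — Gibbs / random-current structure, or a cross-scale rate (§5). -/
theorem not_forall_axisProfilePinningFor : ¬ ∀ g, AxisProfilePinningFor g := by
  intro h
  obtain ⟨g, hF, hKL, -, -, hnp⟩ := exists_axisProfileFacts_not_profilePinned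
  exact hnp (h g hF hKL)

/-! ## §5 In octave / doubling approaches the RATE is load-bearing -/

/-- The log-corrected profile `ℓ(n) = 1/(n (1 + log n))` (`ℓ 0 := 1`): positive, inside the envelope
`[1/n², 1/n]`, octave ratio `ℓ(2n)/ℓ(n) → 1/2`, yet not power-bounded for any exponent. -/
def logProfile (n : ℕ) : ℝ := if n = 0 then 1 else 1 / ((n : ℝ) * (1 + Real.log n))

theorem logProfile_of_pos {n : ℕ} (hn : 1 ≤ n) :
    logProfile n = 1 / ((n : ℝ) * (1 + Real.log n)) := by
  simp [logProfile, show n ≠ 0 by omega]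

theorem one_add_log_pos {n : ℕ} (hn : 1 ≤ n) : 0 < 1 + Real.log (n : ℝ) := by
  have : 0 ≤ Real.log (n : ℝ) := Real.log_nonneg (by exact_mod_cast hn)
  linarith

theorem logProfile_pos {n : ℕ} (hn : 1 ≤ n) : 0 < logProfile n := by
  rw [logProfile_of_pos hn]
  have hn0 : (0 : ℝ) < n := by exact_mod_cast hn
  exact one_div_pos.2 (mul_pos hn0 (one_add_log_pos hn))

/-- `ℓ` lies in the a-priori envelope `1/n² ≤ ℓ(n) ≤ 1/n` (because `1 ≤ 1 + log n ≤ n`). -/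
theorem logProfile_envelope {n : ℕ} (hn : 1 ≤ n) :
    (1 : ℝ) / (n : ℝ) ^ 2 ≤ logProfile n ∧ logProfile n ≤ 1 / (n : ℝ) := by
  rw [logProfile_of_pos hn]
  have hn0 : (0 : ℝ) < n := by exact_mod_cast hn
  have hl := one_add_log_pos hn
  have hlog0 : 0 ≤ Real.log (n : ℝ) := Real.log_nonneg (by exact_mod_cast hn)
  have hlog_le : 1 + Real.log (n : ℝ) ≤ n := by
    have := Real.add_one_le_exp (Real.log (n : ℝ))
    rw [Real.exp_log hn0] at this
    linarith
  constructor
  · rw [div_le_div_iff₀ (by positivity) (by positivity)]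
    nlinarith
  · rw [div_le_div_iff₀ (by positivity) hn0]
    nlinarith

/-- The octave ratio of `ℓ` converges: `ℓ(2n)/ℓ(n) → 1/2`. -/
theorem logProfile_octaveRatio :
    Tendsto (fun n : ℕ => logProfile (2 * n) / logProfile n) atTop (𝓝 (1 / 2)) := by
  have hlog : Tendsto (fun n : ℕ => Real.log (n : ℝ)) atTop atTop :=
    Real.tendsto_log_atTop.comp tendsto_natCast_atTop_atTop
  have hden : Tendsto (fun n : ℕ => 1 + Real.log 2 + Real.log (n : ℝ)) atTop atTop :=
    tendsto_atTop_add_const_left _ _ hlog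
  have hfrac : Tendsto (fun n : ℕ => Real.log 2 / (1 + Real.log 2 + Real.log (n : ℝ))) atTop (𝓝 0) :=
    hden.const_div_atTop (Real.log 2)
  have hlim : Tendsto (fun n : ℕ => (1 / 2 : ℝ) * (1 - Real.log 2 / (1 + Real.log 2 + Real.log (n : ℝ))))
      atTop (𝓝 (1 / 2)) := by
    have h1 : Tendsto (fun n : ℕ => (1 : ℝ) - Real.log 2 / (1 + Real.log 2 + Real.log (n : ℝ))) atTop
        (𝓝 (1 - 0)) := tendsto_const_nhds.sub hfrac
    have h2 := h1.const_mul (1 / 2 : ℝ)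
    rw [sub_zero, mul_one] at h2
    exact h2
  refine hlim.congr' ?_
  filter_upwards [eventually_ge_atTop 1] with n hn
  have hn0 : (0 : ℝ) < n := by exact_mod_cast hn
  have hl := one_add_log_pos hn
  have hl2 : 0 < 1 + Real.log 2 + Real.log (n : ℝ) := by
    have : 0 < Real.log 2 := Real.log_pos (by norm_num)
    linarith
  rw [logProfile_of_pos hn, logProfile_of_pos (by omega)]
  have e2n : Real.log ((2 * n : ℕ) : ℝ) = Real.log 2 + Real.log (n : ℝ) := by
    push_cast
    rw [Real.log_mul (by norm_num) hn0.ne']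
  rw [e2n]
  push_cast
  field_simp
  ring

/-- **`ℓ` is not power-bounded for any exponent**: for `s ≤ 1` the lower bound `c n^{-s} ≤ ℓ(n)` forces
`c (1 + log n) ≤ 1`; for `s > 1` the upper bound `ℓ(n) ≤ C n^{-s}` forces `n^{s-1} ≤ C (1 + log n)`; both absurd. -/
theorem not_profilePinned_logProfile : ¬ ProfilePinned logProfile := by
  rintro ⟨s, c, C, hc, hb⟩
  have hlog : Tendsto (fun n : ℕ => Real.log (n : ℝ)) atTop atTop :=
    Real.tendsto_log_atTop.comp tendsto_natCast_atTop_atTop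
  rcases le_or_gt s 1 with hs | hs
  · -- lower bound fails
    have key : ∀ n : ℕ, 1 ≤ n → c * (1 + Real.log (n : ℝ)) ≤ 1 := by
      intro n hn
      have hn0 : (0 : ℝ) < n := by exact_mod_cast hn
      have hn1 : (1 : ℝ) ≤ n := by exact_mod_cast hn
      have hl := one_add_log_pos hn
      have h := (hb n hn).1
      rw [logProfile_of_pos hn] at h
      have h1 : c * (n : ℝ) ^ (-s) * ((n : ℝ) * (1 + Real.log n)) ≤ 1 := by
        have := mul_le_mul_of_nonneg_right h (le_of_lt (mul_pos hn0 hl))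
        rwa [one_div, inv_mul_cancel₀ (mul_pos hn0 hl).ne'] at this
      have h2 : (n : ℝ) ^ (-s) * (n : ℝ) = (n : ℝ) ^ (1 - s) := by
        rw [show (1 - s) = -s + 1 by ring, Real.rpow_add hn0, Real.rpow_one]
      have h3 : (1 : ℝ) ≤ (n : ℝ) ^ (1 - s) := Real.one_le_rpow hn1 (by linarith)
      calc c * (1 + Real.log (n : ℝ)) = c * 1 * (1 + Real.log (n : ℝ)) := by ring
        _ ≤ c * (n : ℝ) ^ (1 - s) * (1 + Real.log (n : ℝ)) := by
            apply mul_le_mul_of_nonneg_right _ hl.le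
            exact mul_le_mul_of_nonneg_left h3 hc.le
        _ = c * (n : ℝ) ^ (-s) * ((n : ℝ) * (1 + Real.log n)) := by rw [← h2]; ring
        _ ≤ 1 := h1
    have ht : Tendsto (fun n : ℕ => c * (1 + Real.log (n : ℝ))) atTop atTop :=
      Tendsto.const_mul_atTop hc (tendsto_atTop_add_const_left _ _ hlog)
    obtain ⟨n, hgt, hge⟩ := ((ht.eventually_gt_atTop 1).and (eventually_ge_atTop 1)).exists
    exact absurd (key n hge) (not_le.2 hgt)
  · -- upper bound fails: n^{s-1} ≤ C (1 + log n)
    have hC : 0 < C := by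
      have h1 := hb 1 le_rfl
      rw [logProfile_of_pos le_rfl] at h1
      simp only [Nat.cast_one, Real.one_rpow, mul_one, Real.log_one, add_zero, div_one] at h1
      linarith [h1.1, h1.2]
    have key : ∀ n : ℕ, 1 ≤ n → (n : ℝ) ^ (s - 1) ≤ C * (1 + Real.log (n : ℝ)) := by
      intro n hn
      have hn0 : (0 : ℝ) < n := by exact_mod_cast hn
      have hl := one_add_log_pos hn
      have h := (hb n hn).2
      rw [logProfile_of_pos hn] at h
      have h1 : 1 ≤ C * (n : ℝ) ^ (-s) * ((n : ℝ) * (1 + Real.log n)) := by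
        have := mul_le_mul_of_nonneg_right h (le_of_lt (mul_pos hn0 hl))
        rwa [one_div, inv_mul_cancel₀ (mul_pos hn0 hl).ne'] at this
      have hp : (0 : ℝ) < (n : ℝ) ^ (s - 1) := Real.rpow_pos_of_pos hn0 _
      have h2 : (n : ℝ) ^ (s - 1) * ((n : ℝ) ^ (-s) * (n : ℝ)) = 1 := by
        rw [show (n : ℝ) ^ (-s) * (n : ℝ) = (n : ℝ) ^ (-s + 1) by rw [Real.rpow_add hn0, Real.rpow_one],
          ← Real.rpow_add hn0]
        simp
      calc (n : ℝ) ^ (s - 1) = (n : ℝ) ^ (s - 1) * 1 := by ring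
        _ ≤ (n : ℝ) ^ (s - 1) * (C * (n : ℝ) ^ (-s) * ((n : ℝ) * (1 + Real.log n))) :=
            mul_le_mul_of_nonneg_left h1 hp.le
        _ = C * (1 + Real.log (n : ℝ)) * ((n : ℝ) ^ (s - 1) * ((n : ℝ) ^ (-s) * (n : ℝ))) := by ring
        _ = C * (1 + Real.log (n : ℝ)) := by rw [h2, mul_one]
    -- but log n = o(n^{s-1})
    have ho := (isLittleO_log_rpow_atTop (show 0 < s - 1 by linarith)).comp_tendsto
      tendsto_natCast_atTop_atTop
    have hev := ho.bound (show (0 : ℝ) < 1 / (2 * C) by positivity)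
    have hpow : Tendsto (fun n : ℕ => (n : ℝ) ^ (s - 1)) atTop atTop :=
      (tendsto_rpow_atTop (by linarith)).comp tendsto_natCast_atTop_atTop
    obtain ⟨n, hn1, hbig, hsmall⟩ :=
      ((eventually_ge_atTop 1).and ((hpow.eventually_gt_atTop (2 * C)).and hev)).exists
    have hn0 : (0 : ℝ) < n := by exact_mod_cast hn1
    have hp : (0 : ℝ) < (n : ℝ) ^ (s - 1) := Real.rpow_pos_of_pos hn0 _
    simp only [Function.comp] at hsmall
    rw [Real.norm_eq_abs, Real.norm_eq_abs, abs_of_nonneg (Real.log_nonneg (by exact_mod_cast hn1)),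
      abs_of_pos hp] at hsmall
    have k := key n hn1
    have : C * Real.log (n : ℝ) ≤ (n : ℝ) ^ (s - 1) / 2 := by
      calc C * Real.log (n : ℝ) ≤ C * (1 / (2 * C) * (n : ℝ) ^ (s - 1)) :=
            mul_le_mul_of_nonneg_left hsmall hC.le
        _ = (n : ℝ) ^ (s - 1) / 2 := by field_simp
    nlinarith

/-- **An octave-ratio LIMIT does not pin; a RATE does** (the latter is CensusWeb's `dimensionPinned_of_dyadicDiniLaw`):
a positive profile inside the envelope `[1/n², 1/n]` whose octave ratio converges (to `1/2 = 2^{-1}`) and which is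
NOT power-bounded. For the picked line `Sketch`: its dock `DCR₂₇` is a POWER-RATE Cauchy property — weakening it to
mere convergence of block-covariance ratios would void `stub_transfer`. -/
theorem exists_octaveRatioLimit_not_profilePinned :
    ∃ g : ℕ → ℝ, (∀ n : ℕ, 1 ≤ n → 0 < g n) ∧
      (∀ n : ℕ, 1 ≤ n → (1 : ℝ) / (n : ℝ) ^ 2 ≤ g n ∧ g n ≤ 1 / (n : ℝ)) ∧
      Tendsto (fun n : ℕ => g (2 * n) / g n) atTop (𝓝 (1 / 2)) ∧ ¬ ProfilePinned g :=
  ⟨logProfile, fun _ hn => logProfile_pos hn, fun _ hn => logProfile_envelope hn, logProfile_octaveRatio,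
    not_profilePinned_logProfile⟩

/-! ## §6 Natural strengthenings (remarks in the module docstring; nothing here is refutable from the cone) -/

/-- The exact sup-norm law (strengthening (i) of the header): stated for the record; NOT refutable from the
tree (consistent with MMS, lattice symmetry and RP log-convexity), physically false (rotation-invariant limit). -/
def ExactSupNormLaw : Prop :=
  ∃ η A : ℝ, 0 < A ∧ ∀ x : Site 3, x ≠ 0 → criticalTwoPoint 3 x = A * (‖x‖ : ℝ) ^ (-(1 + η))

/-- It would give the crux with `c = C` (so no tightness statement `C/c > 1` is available either). -/
theorem dimensionPinned_of_exactSupNormLaw (h : ExactSupNormLaw) : DimensionPinned := by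
  obtain ⟨η, A, hA, hb⟩ := h
  rw [dimensionPinned_iff]
  exact ⟨η, A, A, hA, fun x hx => ⟨(hb x hx).ge, (hb x hx).le⟩⟩

/-! ## §7 Targets (lead's stuck stubs): none registered this cycle -/

end Summit.CriticalPhenomena.Ising3DConformalLimit.Cruxes.DimensionPinned.Disproof
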